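import Mathlib
import HarnessLib
import HarnessLib.Audit
import Summits.QuantumAdvantage.Statement
import Summits.QuantumAdvantage.QuantumAdvantage.Theorems.StabilizerDialGauge
import Summits.QuantumAdvantage.QuantumAdvantage.Theses.StabilizerDial
import HarnessLib.Audit.Status.Attr

/-!
Route: SparsityDial

# Route SparsityDial — SparsityDial — cut the gauge-generic residual StabGenericLossPos3 (27138) by
the polylog SPARSITY SCALE of the cheap pointer normal form: SparseGenericLoss3 ∧ DenseGenericLoss3

CHILD route (D-0170 `refines route-QuantumAdvantage-StabilizerDial:StabGenericLossPos3`, item 27138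
— the lens-2 lineage's declared
RESIDUAL of the gauge-saturated locus cut of the junction T = PolyLossOddU3 (26531): G says that
every polylog-degree 𝔽₃ strategy of the
n-cycle ring game that NO stabilizer gauge of degree (log₂ n)^(c+1) turns into an (m+1, r)-few-locus
strategy loses an inverse-polynomial
fraction of the odd class; cell decomp-qadv, lens-2 g18 «SparsityDial», Theorems twin part A LANDED
as `Theorems/SparsityDialA.lean`).
It suffices to show X = SparseGenericLoss3 ∧ DenseGenericLoss3, the two halves of an EXACT cut of G.
First the window parameters of G
are irrelevant (landed `stabGenericLossPos3_iff_pointerNormal : G ⟺ G₀₀`, one-line monotonicity of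
`StabFew` in the window budget): G says
exactly «a near-perfect polylog strategy has a CHEAP POINTER NORMAL FORM» (¬ StabFew 1 0 (c+1) P ⇒
loss). Then cut G₀₀'s class at the
polylog SPARSITY SCALE a of the cheap normal form: S = SparseGenericLoss3 (∀ a: strategies that some
cheap gauge sparsifies to (log₂ n)^a
deviation POINTS but none to ONE point lose — the MULTI-POINTER regime, a parity game of
polylog-many cheap pointers against the kernel
phase walk) and D = DenseGenericLoss3 (∃ a: strategies that NO cheap gauge sparsifies to (log₂ n)^a
points lose — the XOR regime). The
node equation `stabGenericLossPos3_iff_sparse_dense : G ⟺ S ∧ D` is a landed theorem and BOTH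
hypothesis classes are certified inhabited
by landed/packaged theorems (E1 `dense_class_nonempty`: the degree-3 antipodal family is in D_a's
class at every scale; E2
`sparse_generic_class_nonempty`: the block-antipodal family is in S_a's class for a ≥ 2c+23), so
neither piece is G in disguise. The
deciding theorem concludes the parent item BY NAME: closes (hS : SparseGenericLoss3) (hD :
DenseGenericLoss3) :
StabilizerDial.StabGenericLossPos3 (dichotomy on `StabFew ((log₂ n)^a) 0 (c+1) P` at the scale a
named by D; window lift
`StabFew 1 0 → StabFew (m+1) r` on the sparse branch; C := max; self-contained over landed
declarations, 0 sorry; the same term is the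
landed `Theorems.SparsityDial.closes_pieces`).
Lean: `(∀ a : ℕ, ∃ C : ℕ, ∀ c : ℕ, ∃ n₀ : ℕ, ∀ n ≥ n₀, ∀ P : Fin n →
Literature.Computability.MetaComplexity.Smolensky.CubeFn (ZMod 3) n, (∀ i, P i ∈
Literature.Computability.MetaComplexity.Smolensky.lowDeg (ZMod 3) n ((Nat.log 2 n) ^ c)) →
Summit.QuantumAdvantage.QuantumAdvantage.Theorems.StabilizerDial.StabFew ((Nat.log 2 n) ^ a) 0 (c +
1) P → ¬ Summit.QuantumAdvantage.QuantumAdvantage.Theorems.StabilizerDial.StabFew 1 0 (c + 1) P →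
((Finset.univ.filter fun x : Fin n → Bool => Summit.QuantumAdvantage.AdviceFreeQNC0.OddZeros x ∧
Literature.Computability.QuantumComplexity.RingHLF.Rel x (fun i => decide (P i x = 1))).card : ℝ) ≤
(1 - 1 / (n : ℝ) ^ C) * (2 : ℝ) ^ (n - 1)) ∧ (∃ a : ℕ, ∃ C : ℕ, ∀ c : ℕ, ∃ n₀ : ℕ, ∀ n ≥ n₀, ∀ P :
Fin n → Literature.Computability.MetaComplexity.Smolensky.CubeFn (ZMod 3) n, (∀ i, P i ∈
Literature.Computability.MetaComplexity.Smolensky.lowDeg (ZMod 3) n ((Nat.log 2 n) ^ c)) → ¬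
Summit.QuantumAdvantage.QuantumAdvantage.Theorems.StabilizerDial.StabFew ((Nat.log 2 n) ^ a) 0 (c +
1) P → ((Finset.univ.filter fun x : Fin n → Bool => Summit.QuantumAdvantage.AdviceFreeQNC0.OddZeros
x ∧ Literature.Computability.QuantumComplexity.RingHLF.Rel x (fun i => decide (P i x = 1))).card :
ℝ) ≤ (1 - 1 / (n : ℝ) ^ C) * (2 : ℝ) ^ (n - 1))`

## Assembly
Pure logic over landed declarations (sketch rc 0, 0 sorry, axioms propext / Classical.choice /
Quot.sound): closes (hS : SparseGenericLoss3)
(hD : DenseGenericLoss3) :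
Summit.QuantumAdvantage.QuantumAdvantage.Theses.StabilizerDial.StabGenericLossPos3 — take the scale
a and constant
C_D from D, C_S from S at that a, C := max C_S C_D, n₀ := max n₁ n₂ 2; given ¬ StabFew (m+1) r (c+1)
P derive ¬ StabFew 1 0 (c+1) P (a
(1, 0)-cover is an (m+1, r)-cover: `LocusDial.FewLocus` unfolded, `Finset.card_le_card`) and split
on StabFew ((log₂ n)^a) 0 (c+1) P:
sparse ⇒ S, dense ⇒ D; loss-shape monotone in C. Both binders consumed (cone 2/2); the same term is
the landed
`Theorems.SparsityDial.closes_pieces`, and `stabGenericLossPos3_iff_sparse_dense` makes the cut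
exact. Upstream the parent's `closes`
(27139 StabSplitGlue3 PROVED, `polyLossOddU3_of_stabPos`) carries U ∧ G to 26531 /
HolonomyDial.AvoidLift3 and `closes_T` to the rung leaf
F-Q1-p3 (`closes_junction`, `closes_parent`, `closes_leaf` landed in SparsityDialA).

REFINES route-QuantumAdvantage-StabilizerDial:StabGenericLossPos3 (edge split, depth 2; chain
route-QuantumAdvantage-HolonomyDial › route-QuantumAdvantage-StabilizerDial ›
route-QuantumAdvantage-SparsityDial) — the deciding theorem of this CHILD route concludes the parent
piece `Summit.QuantumAdvantage.QuantumAdvantage.Theses.StabilizerDial.StabGenericLossPos3` BY NAME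
(imported from Summits.QuantumAdvantage.QuantumAdvantage.Theses.StabilizerDial); closing this route
proves that piece of the parent, never the summit Statement (D-0170).

Rationale: WHY THIS LINE. The generic piece G of the parent cut carries window parameters (m windows of width
r) that are INVISIBLE to it: `StabFew m r e P` is
monotone in the window budget, so the `∀ m r` of G is its (0, 0) instance — G₀₀, «no cheap ONE-POINT
normal form ⇒ loss» — a collapse
nobody had typed (it also re-prices the sibling crux: `polyLossOddU3_iff_one_G : T ⟺
FewLocusLossOne3 ∧ G`). The honest axis left inside
G₀₀ is HOW SPARSE a cheap gauge can make the deviation set: cut at (log₂ n)^a POINTS (width 0;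
`card_le_of_coverable_zero`), a
gauge-SATURATED predicate, hence closed under the row padding that killed g16's many-locus piece
(landed `stabFew_of_stabFew_pad` /
`generic_of_generic_pad` hold at every (m, r)) and free of the zero-window corner that made g17 rev
1 collapse (`denseAt_zero_iff` names the
only corner, D's `∃ a` removes it). The two regimes ask for different mathematics: S is a
localisation / transfer-operator statement about
polylog-many cheap pointers (programs over solvable groups for the kernel phase walk,
BarringtonStraubingTherien1990; the tree's pointer
programme `blindPointer_loss`), D an equidistribution / XOR law for gauge-irreducibly dense
deviation parities (Razborov–Smolensky
technology for 𝔽₃ polynomials versus parity, Smolensky1987,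
[corpus:book:jukna2012-boolean-function-complexity-advances-frontiers pp.364–368];
the relation game of BravyiGossetKonig2018, arXiv:1906.08890). Both strict-weakness certificates are
THEOREMS re-assembled from the landed
antipodal block lemmas (`blockSelect_of_fewLocus`, `goodBound_of_blockRec`) with a polylog window
budget (E1) and a six-sub-block
disjointness count (E2). What no prior route does: every other axis in the cell (ScaleDial loss
scale, CodimDial/SpreadDial covers, RateDial
light cones, FibreDial fibre ceilings, CornerDial variance bands, SliceDial prefix faces, the
parent's few/generic cut) leaves the generic
class G whole; this is the first split of the declared residual 27138 with both halves certified
non-vacuous and strictly below it.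

RANKED CRUXES. #2 SparseGenericLoss3 (crux) — S — the MULTI-POINTER regime at EVERY polylog sparsity
scale (text = the landed `Theorems.SparsityDial.SparseGenericLoss3` unfolded verbatim, Iff.rfl): for
every a there is C such that for all c, eventually in n, every 𝔽₃ strategy of output degree (log₂
n)^c that SOME stabilizer gauge of degree (log₂ n)^(c+1) turns into an a.e.-at-most-(log₂ n)^a-POINT
strategy (StabFew ((log₂ n)^a) 0 (c+1) P) but NONE turns into an a.e.-one-point strategy (¬ StabFew
1 0 (c+1) P) wins at most (1 − n^(−C))·2^(n−1) odd inputs of the n-cycle ring game. G-implied by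
restriction (`sparse_of_G` in the sketch, landed `sparse_of_T`); leaf IDEA-NEEDED with an ATTACKABLE
first rung `BlockAntipodalLoss3` (`blockAntipodalLoss3_of_sparse : S → rung`, node §5; instrument
apwin-v0: block families lose ≈ 1/2). [difficulty: L] (why it might fail: a parity game of
polylog-many cheap pointers may admit a near-perfect player if the kernel phases at far positions
are jointly predictable in low degree — the multi-pointer analogue of the open AffinePointer
question; S also contains U's multi-window content at growing m.) [BravyiGossetKonig2018,
arXiv:1906.08890, BarringtonStraubingTherien1990, Smolensky1987]
#3 DenseGenericLoss3 (crux) — D — the XOR regime beyond SOME polylog sparsity scale, the prover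
NAMES the scale a (text = the landed `Theorems.SparsityDial.DenseGenericLoss3` unfolded verbatim,
Iff.rfl): there are a and C such that for all c, eventually in n, every 𝔽₃ strategy of output degree
(log₂ n)^c that NO stabilizer gauge of degree (log₂ n)^(c+1) turns into an a.e.-at-most-(log₂
n)^a-point strategy (¬ StabFew ((log₂ n)^a) 0 (c+1) P) wins at most (1 − n^(−C))·2^(n−1) odd inputs.
G-implied (a := 0 is G₀₀ ⟺ G, `denseAt_zero_iff`; `denseAt_mono` makes larger a weaker); leaf
IDEA-NEEDED with an ATTACKABLE first rung `AntipodalLoss3` (`antipodalLoss3_of_dense : D → rung`;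
apwin-v0: the antipodal family wins 0.50 on odd n, 0.81 → 0.60 decreasing on even n ≤ 28).
[difficulty: open-problem] (why it might fail: an XOR law for gauge-irreducibly dense deviation
patterns is a Smolensky-type statement for an input-dependent, non-causal parity — no such theorem
is known; the even-n antipodal excess (0.81 → 0.60) shows dense patterns can be biased.)
[Smolensky1987, BravyiGossetKonig2018, arXiv:1906.08890,
book:jukna2012-boolean-function-complexity-advances-frontiers]

TWO-LAYER PLAN. Foreseen, NOT filed now: S ⇐ BlockAntipodalLoss3 (rung, explicit block-antipodal
family; two-arc transfer matrix of constant size) →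
«constant-scale multi-pointer loss» → S (the growing-m pointer game via the kernel phase automaton);
D ⇐ AntipodalLoss3 (rung, the degree-3
antipodal family) → a gauge-irreducible XOR law with ∃ θ < 1 constant loss (the heir of
`StabGenericConstPos3 → G`,
landed `stabGenericLossPos3_of_constPos`) → D. Each a later `--split` with k ≤ 3; no third layer.

KILL CRITERIA. A refutation of SparseGenericLoss3 (a polylog-degree family with a cheap (log₂
n)^a-point normal form, no cheap one-point normal form, winning
a 1 − n^(−ω(1)) fraction of the odd class) closes the route `refuted:SparseGenericLoss3` AND refutes
27138, the junction 26531 and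
T = RingHardOdd 3 (S is T-implied): informative either way; likewise for DenseGenericLoss3. A proof
of 27138, 26531 or RingHardOdd 3
elsewhere moots the route (superseded). A proof of D alone re-targets S as the residual of G (G ⟺ S
given D by the node equation) and the
multi-pointer game becomes the next edit; a proof of S alone re-targets D (the XOR law) — then D's
scale a is the only dial left and a
BARRIER tag needs a theorem placing dense-pattern XOR laws inside NonclassicalDegreeLogBarrier.

NOT DECOMPOSED YET. The rungs `AntipodalLoss3` / `BlockAntipodalLoss3` (node §5, landed-package
Props with `antipodalLoss3_of_dense`, `blockAntipodalLoss3_of_sparse`)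
are BC5 plan-only stubs, NOT items (named-rung rule: outside the cone ⇒ aside at most; a crux lead
registers them); the per-scale pieces
S_a / D_a (`SparseGenericLossAt`, `DenseGenericLossAt`) and the EQUIV normal form G₀₀
(`PointerNormalLoss3`) stay Theorems-side
definitions; the gauge level offset c+1, the a.e. threshold 1/log₂ n and the width-0 convention are
fixed inside the landed definitions; the
sibling crux U (27137) and its one-point slice `PointLoss3` belong to the parent route.

CHEAPEST FALSIFIER. The CORNER and ROW-PADDING tests that killed g16 (`manyLocusLoss3_iff`) and g17
rev 1 (`stabGenericLoss3_iff`), run in the kernel on the new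
axis: `denseAt_zero_iff : D_0 ⟺ G₀₀` is the only corner (hence D is `∃ a`, and the probe «D ⊢ ∀ a,
D_a» fails), padding cannot cross the
sparsity cut (`stabFew_of_stabFew_pad`, saturation), and `split_nondegenerate (a c) (1 ≤ c) (2c+23 ≤
a)` certifies both classes inhabited;
lens probes (23 must-fail, g18/bc/Probe.lean) and the writer's BC2/BC7 batteries found no cheap
collapse S → G, D → G, S → D, D → S. Next
cheapest: exhibit ONE polylog-degree family in D_a's class for every a with win rate 1 − o(1) (the
antipodal family sits at ≈ 1/2).

NUMBERS. Sparsity thresholds (log₂ n)^a points, a ∈ ℕ (S: all a; D: one a); gauge degree (log₂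
n)^(c+1) for strategy degree (log₂ n)^c; E1: antipodal
family generic at window budget ((log₂ n)^a, (log₂ n)^a) once (72·279936+40)·(log₂ n)^(2a+2e) ≤ n/2;
E2: block-antipodal family `bpStrat
(kBlk n e)`, kBlk N e = 3456·(8(log₂ N)^e+1)², in S_a's class for a ≥ 2c+23, double count 5·(1 −
1/16) > 6·(3/4); instrument apwin-v0
(node §8, g18/scratch/apwin_6_28.txt): antipodal .688…​.597 (even n 8…28), .547…​.500 (odd n 7…27);
block-antipodal → .5000; pointer value
2/3 (`blindPointer_loss`); known regime of T: output degree ≤ 1 (`AffBells37.affBellsPolyLoss3`).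
Items at open: 3 (2 cruxes + assembly).

DEFINITION REQUESTS. None: `StabFew`, `FewLocus`, `Coverable`, `pad` are landed Theorems-side
definitions (StabilizerDialGauge{A,}, LocusDialPieces); the pieces'
named forms `SparseGenericLossAt/DenseGenericLossAt/SparseGenericLoss3/DenseGenericLoss3` are landed
in `Theorems/SparsityDialA.lean`
(Iff.rfl with the items); the route imports
`Summits.QuantumAdvantage.QuantumAdvantage.Theorems.StabilizerDialGauge` only (the parent Theses
module is added by the gate for `refines`; no cycle: SparsityDialA does not import any Theses file
of this lineage other than ExactnessDial's cone).

Novelty: Searches (2026-08-31, writer g8; lens-2 g18 searches in NODE-g18 §5): `lit search --hybrid "sparse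
normal form low-degree polynomial strategies parity game pointers hidden linear function" -n 8` (8
docs, all noise — null); `lit vsearch "<D in prose>" -k 8` (1 relevant:
[corpus:book:jukna2012-boolean-function-complexity-advances-frontiers pp.176,597,604], Smolensky
material pp.364–368; rest noise); `lit search --hybrid "correlation bounds polynomials parity
Smolensky barrier degree log" -n 6`
([corpus:book:jukna2012-boolean-function-complexity-advances-frontiers pp.364,368,626],
[corpus:book:arora2009-computational-complexity-modern-approach p.359]); `lit galaxy search "hidden
linear function|HLF problem|shallow Clifford circuits" --star all -n 10` (panama 10 noise, crabby 0,
pdf: [galaxy:pdf:3005872880] Bravyi–Gosset–König arXiv:1704.00690, [galaxy:pdf:-2756880049553291600]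
Grewal–Kumar ECCC 2024/130); `lit galaxy search "correlation bounds for polynomials|nonclassical
polynomials|Razborov-Smolensky" --star pdf -n 8` (Grewal–Kumar again; Chan–Williams derandomized
Razborov–Smolensky — algorithmic, distant); tree `rg "SparseGenericLoss3|StabFew ((Nat.log 2 n) ^"`
= only the landed twin SparsityDialA of this node.
Nearest prior art found: in tree `Theorems.StabilizerDial.antipodalGenericPos3` /
`antipodal_class_nonempty` (constant window budget; E1 is its polylog re-assembly) and the parent
route's G (27138); in print BravyiGossetKonig2018 ([galaxy:pdf:3005872880], the ring/2D  [refs: 1704.00690, book:jukna2012-boolean-function-complexity-advances-frontiers, book:arora2009-computational-complexity-modern-approach, BravyiGossetKonig2018, Smolensky1987]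

Barriers (technique_class: decomposition, gauge saturation, correlation bounds): - technique_class: decomposition, gauge saturation, correlation bounds
- Literature.Barriers.QuantumAdvantage.NonclassicalDegreeLogBarrier: S and D are loss (not 2^(−Ω)
correlation) bounds for polylog-degree 𝔽₃ polynomials against the ring RELATION restricted to
gauge-saturated classes — inside the general low-degree-correlation family the barrier speaks to
([galaxy:pdf:6032370442476464720] Bhowmick–Lovett: exact-correlation barriers at degree ≥ log n for
Boolean targets), but neither requires beating it head-on as typed: they are restrictions of the
filed 27138/26531 and inherit their placement; S's attack goes through the kernel phase walk /
multi-pointer transfer operators (outside the barrier's quantifiers), honest residue: a proof of D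
by a pointwise Smolensky bound at degree (log n)^c would re-enter the class — the bet is an
equidistribution law specific to gauge-irreducible deviation parities of the relation game.
- Literature.Barriers.QuantumAdvantage.TwoModuliDepthTwo: inside the two-moduli shadow exactly as
the parent (parities of 𝔽₃-polynomial bits against one 𝔽₂ relation); the barriers that actually bite
dichotomies on this junction are the lineage's ROW-PADDING collapse (landed `manyLocusLoss3_iff`)
and ZERO-WINDOW CORNER (landed `stabGenericLoss3_iff`) — S and D are placed OUTSIDE both by theorem
(`stabFew_of_stabFew_pad` saturation at every (m, r); `denseAt_zero_iff` + D's ∃ a);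
[corpus:book:jukna2012-boolean-function-complexity-advances-frontiers p.368] is the

History (route lifecycle, newest last):
- 2026-08-31T09:41:02Z · RESIDUAL cleared: DenseGenericLoss3 (stmt-QuantumAdvantage-27656) — declared attackable: split gen 1 (rev 2, commit 013104e307b9): DenseGenericLoss3 = CounterLoss3 ∧ NonCounterGenericLoss3 EXACTLY (Theorems.Sp (planner-decomp-qadv-writer-1-g11-0)

sub-problem: QuantumAdvantage · status: draft · opened planner-decomp-qadv-writer-1-g8-0 2026-08-31T03:27:08Z · rev 3 · ledger route-QuantumAdvantage-SparsityDial
GENERATED by the gate from the ledger (D-0016/17). Provers cite these decls: `theorem foo : Summit.QuantumAdvantage.QuantumAdvantage.Theses.SparsityDial.<Decl> := …` in Summits/QuantumAdvantage/QuantumAdvantage/Theorems/<Name>.lean.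
-/

namespace Summit.QuantumAdvantage.QuantumAdvantage.Theses.SparsityDial

open scoped BigOperators Topology Manifold Classical MeasureTheory ProbabilityTheory Matrix InnerProductSpace ComplexConjugate ContinuousMap
open Filter Set Function TopologicalSpace MeasureTheory

attribute [summit_statement] _root_.QuantumAdvantage
attribute [summit_statement] _root_.Summit.QuantumAdvantage.QuantumAdvantage.Theses.StabilizerDial.StabGenericLossPos3

open Literature.QuantumAdvantage

/-- item stmt-QuantumAdvantage-27655 · crux · leaf IDEA-NEEDED · rank 2 · open · by planner
why it might fail: a parity game of polylog-many cheap pointers may admit a near-perfect player if the kernel phases at far positions are jointly predictable in low degree — the multi-pointer analogue of the open AffinePointer question; S also contains U's multi-window content at growing m.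
sources: BravyiGossetKonig2018, arXiv:1906.08890, BarringtonStraubingTherien1990, Smolensky1987
[crux] S — the MULTI-POINTER regime at EVERY polylog sparsity scale (text = the landed
`Theorems.SparsityDial.SparseGenericLoss3` unfolded verbatim, Iff.rfl): for every a there is C such
that for all c, eventually in n, every 𝔽₃ strategy of output degree (log₂ n)^c that SOME stabilizer
gauge of degree (log₂ n)^(c+1) turns into an a.e.-at-most-(log₂ n)^a-POINT strategy (StabFew ((log₂
n)^a) 0 (c+1) P) but NONE turns into an a.e.-one-point strategy (¬ StabFew 1 0 (c+1) P) wins at most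
(1 − n^(−C))·2^(n−1) odd inputs of the n-cycle ring game. G-implied by restriction (`sparse_of_G` in
the sketch, landed `sparse_of_T`); leaf IDEA-NEEDED with an ATTACKABLE first rung
`BlockAntipodalLoss3` (`blockAntipodalLoss3_of_sparse : S → rung`, node §5; instrument apwin-v0:
block families lose ≈ 1/2). [difficulty: L] -/
@[route_item "route-QuantumAdvantage-SparsityDial", crux (bottleneck := idea) (source := "ledger D-0171 leaf tag IDEA-NEEDED on stmt-QuantumAdvantage-27655, 2026-09-01")]
def SparseGenericLoss3 : Prop :=
  ∀ a : ℕ, ∃ C : ℕ, ∀ c : ℕ, ∃ n₀ : ℕ, ∀ n ≥ n₀, ∀ P : Fin n → Literature.Computability.MetaComplexity.Smolensky.CubeFn (ZMod 3) n, (∀ i, P i ∈ Literature.Computability.MetaComplexity.Smolensky.lowDeg (ZMod 3) n ((Nat.log 2 n) ^ c)) → Summit.QuantumAdvantage.QuantumAdvantage.Theorems.StabilizerDial.StabFew ((Nat.log 2 n) ^ a) 0 (c + 1) P → ¬ Summit.QuantumAdvantage.QuantumAdvantage.Theorems.StabilizerDial.StabFew 1 0 (c + 1) P → ((Finset.univ.filter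 fun x : Fin n → Bool => Summit.QuantumAdvantage.AdviceFreeQNC0.OddZeros x ∧ Literature.Computability.QuantumComplexity.RingHLF.Rel x (fun i => decide (P i x = 1))).card : ℝ) ≤ (1 - 1 / (n : ℝ) ^ C) * (2 : ℝ) ^ (n - 1)

/-- item stmt-QuantumAdvantage-27656 · crux · leaf IDEA-NEEDED · rank 3 · SPLIT (gen 1) into CounterLoss3, NonCounterGenericLoss3 + glue CounterSplitGlue3 · direct attempts still welcome (low priority) · by planner
why it might fail: an XOR law for gauge-irreducibly dense deviation patterns is a Smolensky-type statement for an input-dependent, non-causal parity — no such theorem is known; the even-n antipodal excess (0.81 → 0.60) shows dense patterns can be biased.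
sources: Smolensky1987, BravyiGossetKonig2018, arXiv:1906.08890, book:jukna2012-boolean-function-complexity-advances-frontiers
[crux] D — the XOR regime beyond SOME polylog sparsity scale, the prover NAMES the scale a (text =
the landed `Theorems.SparsityDial.DenseGenericLoss3` unfolded verbatim, Iff.rfl): there are a and C
such that for all c, eventually in n, every 𝔽₃ strategy of output degree (log₂ n)^c that NO
stabilizer gauge of degree (log₂ n)^(c+1) turns into an a.e.-at-most-(log₂ n)^a-point strategy (¬
StabFew ((log₂ n)^a) 0 (c+1) P) wins at most (1 − n^(−C))·2^(n−1) odd inputs. G-implied (a := 0 is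
G₀₀ ⟺ G, `denseAt_zero_iff`; `denseAt_mono` makes larger a weaker); leaf IDEA-NEEDED with an
ATTACKABLE first rung `AntipodalLoss3` (`antipodalLoss3_of_dense : D → rung`; apwin-v0: the
antipodal family wins 0.50 on odd n, 0.81 → 0.60 decreasing on even n ≤ 28). [difficulty:
open-problem] -/
@[route_item "route-QuantumAdvantage-SparsityDial", crux (bottleneck := idea) (source := "ledger D-0171 leaf tag IDEA-NEEDED on stmt-QuantumAdvantage-27656, 2026-09-01")]
def DenseGenericLoss3 : Prop :=
  ∃ a : ℕ, ∃ C : ℕ, ∀ c : ℕ, ∃ n₀ : ℕ, ∀ n ≥ n₀, ∀ P : Fin n → Literature.Computability.MetaComplexity.Smolensky.CubeFn (ZMod 3) n, (∀ i, P i ∈ Literature.Computability.MetaComplexity.Smolensky.lowDeg (ZMod 3) n ((Nat.log 2 n) ^ c)) → ¬ Summit.QuantumAdvantage.QuantumAdvantage.Theorems.StabilizerDial.StabFew ((Nat.log 2 n) ^ a) 0 (c + 1) P → ((Finset.univ.filter fun x : Fin n → Bool => Summit.QuantumAdvantage.AdviceFreeQNC0.OddZeros x ∧ Literature.Computability.QuantumComplexity.RingHLF.Rel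 x (fun i => decide (P i x = 1))).card : ℝ) ≤ (1 - 1 / (n : ℝ) ^ C) * (2 : ℝ) ^ (n - 1)

-- parent: DenseGenericLoss3 · child (gen 1)
/--     item stmt-QuantumAdvantage-27008 · crux · leaf ATTACKABLE · rank 301 · open
    parent: DenseGenericLoss3 · by planner
    why it might fail: A implies FullPaleyCounterLoss3 (N101, undecided): if the full-Paley window counters win > 1 - n^(-C) of the odd class for every C infinitely often, A is false while B survives; gap-free counter fields have no dark window by fiat, so the dark-window engine alone does not reach them.
    sources: BarringtonStraubingTherien1990, GrolmuszTardos2000, KawalekWeiss2023, BravyiGossetKonig2018, arXiv:1906.08890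
[crux] A = SPECIAL piece «CounterLoss3» of the COUNTER-FORM DIAL (lens-2 g21 node «CounterDial»
bd72490c…, critic 69v52 CLEARED-as-RESIDUAL-SPLIT, 69v53 twins landed as Theorems/CounterDial{A,B};
text = the landed `Theorems.CounterDial.CounterLoss3` with `StabCounter`/`CounterForm`/`lin`
unfolded verbatim — Iff.rfl, writer g10 rt-sd/SplitJunction.lean rc 0): there are a, C such that for
all c, eventually in n, every F3 strategy of output degree (log2 n)^c that is DENSE (not StabFew
((log2 n)^a) 0 (c+1) P) and CHEAPLY COUNTER-FORM — some stabilizer pad by selectors of degree <=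
(log2 n)^(c+1) has every deviation gate a LEVEL SET OF A Z3-LINEAR FORM of the input bits (k in dev
<-> Sum_i alpha_ki [x_i] in A_k) — wins at most (1 - n^(-C))*2^(n-1) odd inputs of the n-cycle ring
game. WEAKER than D by restriction (`counter_of_dense` : D -> A; A |- D must-fail, critic F4 /
writer bc-cd/BC2_probes), OPEN, leaf ATTACKABLE: engine = the node's DARK-WINDOW LAW
(`dark_orbit_loses` / `dark_loss_count`: a window of 4 adjacent cells on which the deviation set is
constant costs >= 1/8 of its 8-point orbit); decided sub-rungs `gappedCounterLoss3`,
`punchedCounterLoss3 W` (every W), `punchedFullPale -/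
@[route_item "route-QuantumAdvantage-SparsityDial", crux (bottleneck := work) (source := "ledger D-0171 leaf tag ATTACKABLE on stmt-QuantumAdvantage-27008, 2026-09-01")]
def CounterLoss3 : Prop :=
  ∃ a : ℕ, ∃ C : ℕ, ∀ c : ℕ, ∃ n₀ : ℕ, ∀ n ≥ n₀, ∀ P : Fin n → Literature.Computability.MetaComplexity.Smolensky.CubeFn (ZMod 3) n, (∀ i, P i ∈ Literature.Computability.MetaComplexity.Smolensky.lowDeg (ZMod 3) n ((Nat.log 2 n) ^ c)) → ¬ Summit.QuantumAdvantage.QuantumAdvantage.Theorems.StabilizerDial.StabFew ((Nat.log 2 n) ^ a) 0 (c + 1) P → (∃ s : Fin n → Literature.Computability.MetaComplexity.Smolensky.CubeFn (ZMod 3) n, (∀ i, s i ∈ Literature.Computability.MetaComplexity.Smolensky.lowDeg (ZMod 3) n ((Nat.log 2 n) ^ (c + 1))) ∧ ∃ (α : Fin n → Fin n → ZMod 3) (A : Fin n → Finset (ZMod 3)), ∀ x : Fin n → Bool, Summit.QuantumAdvantage.AdviceFreeQNC0.OddZeros x → ∀ k : Fin n, k ∈ Summit.QuantumAdvantage.QuantumAdvantage.Theorems.AnchorDial.dev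 (Summit.QuantumAdvantage.QuantumAdvantage.Theorems.StabilizerDial.pad P s) x ↔ (∑ i, if x i then α k i else 0) ∈ A k) → ((Finset.univ.filter fun x : Fin n → Bool => Summit.QuantumAdvantage.AdviceFreeQNC0.OddZeros x ∧ Literature.Computability.QuantumComplexity.RingHLF.Rel x (fun i => decide (P i x = 1))).card : ℝ) ≤ (1 - 1 / (n : ℝ) ^ C) * (2 : ℝ) ^ (n - 1)

-- parent: DenseGenericLoss3 · child (gen 1)
/--     item stmt-QuantumAdvantage-27009 · crux · RESIDUAL (gen 1; summit-strength until shown otherwise, D-0170) · leaf IDEA-NEEDED · rank 302 · open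
    parent: DenseGenericLoss3 · by planner
    why it might fail: An XOR law for input-dependent AND-bottom deviation fields is the open d >= 2 regime of the two-moduli / Constant-Degree barrier (TwoModuliDepthTwo; KawalekWeiss2023 pp. 1-4): nothing in print reaches it, and one biased dense AND-reader family refutes B and D together.
    sources: KawalekWeiss2023, GrolmuszTardos2000, BarringtonStraubingTherien1990, Smolensky1987, BravyiGossetKonig2018
[residual] B = GENERIC piece «NonCounterGenericLoss3» — the route's DECLARED RESIDUAL re-pointed
from D (critic 69v52: «residual re-pointed to B tagged RESIDUAL»; text = the landed
`Theorems.CounterDial.NonCounterGenericLoss3` with `StabCounter` unfolded verbatim, Iff.rfl): A's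
statement with the counter-form hypothesis NEGATED — dense strategies NO cheap stabilizer pad of
which is in counter form (some deviation gate needs an AND layer, e.g. a reader of x1∧x2∧x3) lose
polynomially. WEAKER than D by restriction (`nonCounter_of_dense` : D -> B; B |- D must-fail, critic
F5) but EQUIVALENT TO D MODULO THE OPEN A (critic C1: A -> (B <-> D)); essentially all of D's open
difficulty sits here (critic C2): the AND-bottom / d >= 2 regime of the Constant-Degree Hypothesis,
recorded OPEN in Literature.Barriers.QuantumAdvantage.TwoModuliDepthTwo (KawalekWeiss2023 pp. 1-4;
GrolmuszTardos2000). Leaf IDEA-NEEDED (an AND-bottom loss law, or the dark-window law IN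
EXPECTATION); no undecided inhabitant typed yet: the node's exemplar (the CUBE family —
`cube_in_dense_class`, `cube_not_counterForm_zero` at the ZERO gauge) is itself DECIDED by the
dark-window law (critic C3: `cube_dark`, `cube_loss`, l -/
@[route_item "route-QuantumAdvantage-SparsityDial"]
def NonCounterGenericLoss3 : Prop :=
  ∃ a : ℕ, ∃ C : ℕ, ∀ c : ℕ, ∃ n₀ : ℕ, ∀ n ≥ n₀, ∀ P : Fin n → Literature.Computability.MetaComplexity.Smolensky.CubeFn (ZMod 3) n, (∀ i, P i ∈ Literature.Computability.MetaComplexity.Smolensky.lowDeg (ZMod 3) n ((Nat.log 2 n) ^ c)) → ¬ Summit.QuantumAdvantage.QuantumAdvantage.Theorems.StabilizerDial.StabFew ((Nat.log 2 n) ^ a) 0 (c + 1) P → ¬ (∃ s : Fin n → Literature.Computability.MetaComplexity.Smolensky.CubeFn (ZMod 3) n, (∀ i, s i ∈ Literature.Computability.MetaComplexity.Smolensky.lowDeg (ZMod 3) n ((Nat.log 2 n) ^ (c + 1))) ∧ ∃ (α : Fin n → Fin n → ZMod 3) (A : Fin n → Finset (ZMod 3)), ∀ x : Fin n → Bool, Summit.QuantumAdvantage.AdviceFreeQNC0.OddZeros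 x → ∀ k : Fin n, k ∈ Summit.QuantumAdvantage.QuantumAdvantage.Theorems.AnchorDial.dev (Summit.QuantumAdvantage.QuantumAdvantage.Theorems.StabilizerDial.pad P s) x ↔ (∑ i, if x i then α k i else 0) ∈ A k) → ((Finset.univ.filter fun x : Fin n → Bool => Summit.QuantumAdvantage.AdviceFreeQNC0.OddZeros x ∧ Literature.Computability.QuantumComplexity.RingHLF.Rel x (fun i => decide (P i x = 1))).card : ℝ) ≤ (1 - 1 / (n : ℝ) ^ C) * (2 : ℝ) ^ (n - 1)

-- parent: DenseGenericLoss3 · glue (gen 1)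
/--     item stmt-QuantumAdvantage-27010 · support · rank 303 · closed · proved by Summit.QuantumAdvantage.QuantumAdvantage.Theorems.SparsityDial.counterSplitGlue3 (planner)
    parent: DenseGenericLoss3 · GLUE: children ⟹ parent · by planner
CounterLoss3 → NonCounterGenericLoss3 → DenseGenericLoss3: by cases on the counter-form gauge
(StabCounter (c+1) P), a, C, n₀ := max — PROVED in the tree as
Summit.QuantumAdvantage.QuantumAdvantage.Theorems.CounterDial.closes (Theorems/CounterDialB.lean,
landed census l.1655), whose hypotheses are the two children by Iff.rfl (writer
rt-sd/SplitJunction.lean rc 0: splitGlue_holds := Theorems.CounterDial.closes elaborates against the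
inlined texts); it cannot be cited inside this file (CounterDialB imports Theses.SparsityDial), so
the glue item is closed by a one-line standalone Theorems file (LAND-ASK to census on the cell bus).
Exactness: dense_iff_split (D ↔ A ∧ B). -/
@[route_item "route-QuantumAdvantage-SparsityDial"]
def CounterSplitGlue3 : Prop :=
  CounterLoss3 → NonCounterGenericLoss3 → DenseGenericLoss3

-- `CounterSplitGlue3` holds: proved by `Summit.QuantumAdvantage.QuantumAdvantage.Theorems.SparsityDial.counterSplitGlue3` (its module imports this route file, so no `_holds` link can be stated here).

-- parent: DenseGenericLoss3 · child (gen 3)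
/--     item stmt-QuantumAdvantage-27418 · crux · leaf ATTACKABLE · rank 301 · open
    parent: DenseGenericLoss3 · by operator
    why it might fail: A implies FullPaleyCounterLoss3 (N101, undecided): if the full-Paley window counters win > 1 - n^(-C) of the odd class for every C infinitely often, A is false while B survives; gap-free counter fields have no dark window by fiat, so the dark-window engine alone does not reach them.
    sources: BarringtonStraubingTherien1990, GrolmuszTardos2000, KawalekWeiss2023, BravyiGossetKonig2018, arXiv:1906.08890
[crux «A» = item stmt-QuantumAdvantage-27008 UNCHANGED, re-attached BY SIGNATURE in the gen-2
RESPLIT of DenseGenericLoss3 27656 (lens-2 g23 AbelianDial; critic 69v55 VEHICLE RULING (b): resplit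
D into [A by name] ∧ S ∧ G; 69v56). Text, kind, rank, leaf tag, why and sources identical to the
gen-1 filing (writer g10, critic 69v52): COUNTER side of the counter dial — dense deviation fields
that ARE cheaply counter-form (StabCounter) lose polynomially. -/
@[route_item "route-QuantumAdvantage-SparsityDial"]
def CounterLoss32 : Prop :=
  ∃ a : ℕ, ∃ C : ℕ, ∀ c : ℕ, ∃ n₀ : ℕ, ∀ n ≥ n₀, ∀ P : Fin n → Literature.Computability.MetaComplexity.Smolensky.CubeFn (ZMod 3) n, (∀ i, P i ∈ Literature.Computability.MetaComplexity.Smolensky.lowDeg (ZMod 3) n ((Nat.log 2 n) ^ c)) → ¬ Summit.QuantumAdvantage.QuantumAdvantage.Theorems.StabilizerDial.StabFew ((Nat.log 2 n) ^ a) 0 (c + 1) P → (∃ s : Fin n → Literature.Computability.MetaComplexity.Smolensky.CubeFn (ZMod 3) n, (∀ i, s i ∈ Literature.Computability.MetaComplexity.Smolensky.lowDeg (ZMod 3) n ((Nat.log 2 n) ^ (c + 1))) ∧ ∃ (α : Fin n → Fin n → ZMod 3) (A : Fin n → Finset (ZMod 3)), ∀ x : Fin n → Bool, Summit.QuantumAdvantage.AdviceFreeQNC0.OddZeros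 x → ∀ k : Fin n, k ∈ Summit.QuantumAdvantage.QuantumAdvantage.Theorems.AnchorDial.dev (Summit.QuantumAdvantage.QuantumAdvantage.Theorems.StabilizerDial.pad P s) x ↔ (∑ i, if x i then α k i else 0) ∈ A k) → ((Finset.univ.filter fun x : Fin n → Bool => Summit.QuantumAdvantage.AdviceFreeQNC0.OddZeros x ∧ Literature.Computability.QuantumComplexity.RingHLF.Rel x (fun i => decide (P i x = 1))).card : ℝ) ≤ (1 - 1 / (n : ℝ) ^ C) * (2 : ℝ) ^ (n - 1)

-- parent: DenseGenericLoss3 · child (gen 3)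
/--     item stmt-QuantumAdvantage-27419 · crux · leaf ATTACKABLE · rank 302 · open
    parent: DenseGenericLoss3 · by operator
    why it might fail: Some bounded abelian type (m, r) with r ≥ 2 or modulus ≠ 3 may carry a dense non-counter table strategy winning > 1 − n^(−C) of the odd class for every C (HxLoss3 at type (2,2) is undecided); the decided rungs cover gapped tables, type (1,1) and the pm twins only.
    sources: BarringtonStraubingTherien1990, GrolmuszTardos2000, KawalekWeiss2023, arXiv:1906.08890
[crux «S» SPECIAL piece of the lens-2 g23 AbelianDial resplit of DenseGenericLoss3 27656 (EXACT: B =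
NonCounterGenericLoss3 27009 ↔ S ∧ G, kernel Theorems.AbelianDial.split_iff; D ↔ A ∧ S ∧ G; critic
69v55 CLEARED-as-RESIDUAL-SPLIT, 69v56 VERIFIED REV3; INLINE text =
Theorems.AbelianDial.AbelianLoss3 by Iff.rfl, writer rt-ab/ResplitCheck.lean)] For EVERY bounded
abelian type (m, r): dense (¬StabFew), NOT cheaply counter-form, but cheaply (m, r)-TABLE-form
(after a cheap stabilizer gauge every deviation gate is a Boolean table G k of r Z_{m+1}-linear
readouts of the input) ⟹ polynomial loss on the odd class (a, C may depend on (m, r)). WEAKER than B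
(abelian_of_B); converse must-fail. DECIDED SUB-RUNGS in tree: gappedTableLoss (any type,
Theorems.AbelianDialB), TYPE (1,1) ENTIRE abelianLoss3_one_one (parity tables, n₀ = 32), ★ twin
coincidence law PmLoss3 (parity-mixed twin-XOR family loses, C = 1, n ≥ 2¹⁵, Theorems.AbelianDialE);
VACUOUS sectors (m,0) and (2,1) (counter form = type (2,1) exactly: stabCounter_iff_stabTable21).
UNDECIDED named instances / next tests: HxLoss3 (hxStrat, type (2,2) at the zero gauge), Paley-type
twins, all-gauge ¬StabCounter pmStrat. Polylog-type varian -/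
@[route_item "route-QuantumAdvantage-SparsityDial", crux (bottleneck := work) (source := "ledger D-0171 leaf tag ATTACKABLE on stmt-QuantumAdvantage-27419, 2026-09-01")]
def AbelianLoss3 : Prop :=
  ∀ m r : ℕ, ∃ a : ℕ, ∃ C : ℕ, ∀ c : ℕ, ∃ n₀ : ℕ, ∀ n ≥ n₀, ∀ P : Fin n → Literature.Computability.MetaComplexity.Smolensky.CubeFn (ZMod 3) n, (∀ i, P i ∈ Literature.Computability.MetaComplexity.Smolensky.lowDeg (ZMod 3) n ((Nat.log 2 n) ^ c)) → ¬ Summit.QuantumAdvantage.QuantumAdvantage.Theorems.StabilizerDial.StabFew ((Nat.log 2 n) ^ a) 0 (c + 1) P → ¬ (∃ s : Fin n → Literature.Computability.MetaComplexity.Smolensky.CubeFn (ZMod 3) n, (∀ i, s i ∈ Literature.Computability.MetaComplexity.Smolensky.lowDeg (ZMod 3) n ((Nat.log 2 n) ^ (c + 1))) ∧ ∃ (α : Fin n → Fin n → ZMod 3) (A : Fin n → Finset (ZMod 3)), ∀ x : Fin n → Bool, Summit.QuantumAdvantage.AdviceFreeQNC0.OddZeros x → ∀ k : Fin n, k ∈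 Summit.QuantumAdvantage.QuantumAdvantage.Theorems.AnchorDial.dev (Summit.QuantumAdvantage.QuantumAdvantage.Theorems.StabilizerDial.pad P s) x ↔ (∑ i, if x i then α k i else 0) ∈ A k) → (∃ s : Fin n → Literature.Computability.MetaComplexity.Smolensky.CubeFn (ZMod 3) n, (∀ i, s i ∈ Literature.Computability.MetaComplexity.Smolensky.lowDeg (ZMod 3) n ((Nat.log 2 n) ^ (c + 1))) ∧ ∃ (v : Fin n → Fin n → Fin r → ZMod (m + 1)) (G : Fin n → (Fin r → ZMod (m + 1)) → Bool), ∀ x : Fin n → Bool, Summit.QuantumAdvantage.AdviceFreeQNC0.OddZeros x → ∀ k : Fin n, k ∈ Summit.QuantumAdvantage.QuantumAdvantage.Theorems.AnchorDial.dev (Summit.QuantumAdvantage.QuantumAdvantage.Theorems.StabilizerDial.pad P s) x ↔ G k (fun j => ∑ i, if x i then v k i j else 0) = true) → ((Finset.univ.filter fun x : Fin n → Bool => Summit.QuantumAdvantage.AdviceFreeQNC0.OddZeros x ∧ Literature.Computability.QuantumComplexity.RingHLF.Rel x (fun i => decide (P i x = 1))).card : ℝ) ≤ (1 - 1 / (n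 : ℝ) ^ C) * (2 : ℝ) ^ (n - 1)

-- parent: DenseGenericLoss3 · child (gen 3)
/--     item stmt-QuantumAdvantage-27420 · crux · RESIDUAL (gen 0; summit-strength until shown otherwise, D-0170) · leaf IDEA-NEEDED · rank 303 · open
    parent: DenseGenericLoss3 · by operator
    why it might fail: It is B minus one bounded abelian type: non-table deviation fields (quadratic readouts and beyond, or abelian of unbounded rank) sit in the open d ≥ 2 regime of the two-moduli / constant-degree barrier (TwoModuliDepthTwo; KawalekWeiss2023); one dense qStrat-like winning family refutes G, B, D.
    sources: KawalekWeiss2023, GrolmuszTardos2000, BarringtonStraubingTherien1990, Smolensky1987, BravyiGossetKonig2018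
[residual (gen 2) «G» GENERIC piece = the re-typed RESIDUAL of the lens-2 g23 AbelianDial resplit of
DenseGenericLoss3 27656 (supersedes NonCounterGenericLoss3 27009 as residual of record: B ↔ S ∧ G
exact, G ≡ B modulo the OPEN S; critic 69v55/69v56; INLINE text =
Theorems.AbelianDial.NonAbelianLoss3 by Iff.rfl)] For SOME bounded abelian type T₀ = (m, r): dense,
not cheaply counter-form and NOT cheaply T₀-table-form ⟹ polynomial loss. READING (critic 69v55 N1):
class = B minus ONE bounded abelian type T₀ — it still CONTAINS linear phases of every type ⊄ T₀
(foreign modulus, rank > r, rank growing with n); «non-abelian» is relative to T₀, not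
«quadratic-or-higher phases» and not literally the CDH d ≥ 2 frontier (print's decided d = 1 regime
[BST90, GT00] has unbounded rank at fixed modulus; S is a proper sub-case; G straddles). WEAKER than
B (nonAbelian_of_B); converse must-fail; INHABITED WITH CERTIFICATE FOR EVERY TYPE at the zero gauge
(qStrat rotating quadratic matchings: q_not_tableForm_zero ∀ m r by collision/pigeonhole,
q_not_counterForm_zero, q_in_dense_class — Theorems.AbelianDialC; even for every polylog-size type:
q_not_smallTable_zero, AbelianDialF); UNDECIDED (test: a l -/
@[route_item "route-QuantumAdvantage-SparsityDial", crux (bottleneck := idea) (source := "ledger wanted_by.residual on stmt-QuantumAdvantage-27420, 2026-09-01")]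
def NonAbelianLoss3 : Prop :=
  ∃ m r : ℕ, ∃ a : ℕ, ∃ C : ℕ, ∀ c : ℕ, ∃ n₀ : ℕ, ∀ n ≥ n₀, ∀ P : Fin n → Literature.Computability.MetaComplexity.Smolensky.CubeFn (ZMod 3) n, (∀ i, P i ∈ Literature.Computability.MetaComplexity.Smolensky.lowDeg (ZMod 3) n ((Nat.log 2 n) ^ c)) → ¬ Summit.QuantumAdvantage.QuantumAdvantage.Theorems.StabilizerDial.StabFew ((Nat.log 2 n) ^ a) 0 (c + 1) P → ¬ (∃ s : Fin n → Literature.Computability.MetaComplexity.Smolensky.CubeFn (ZMod 3) n, (∀ i, s i ∈ Literature.Computability.MetaComplexity.Smolensky.lowDeg (ZMod 3) n ((Nat.log 2 n) ^ (c + 1))) ∧ ∃ (α : Fin n → Fin n → ZMod 3) (A : Fin n → Finset (ZMod 3)), ∀ x : Fin n → Bool, Summit.QuantumAdvantage.AdviceFreeQNC0.OddZeros x → ∀ k : Fin n, k ∈ Summit.QuantumAdvantage.QuantumAdvantage.Theorems.AnchorDial.dev (Summit.QuantumAdvantage.QuantumAdvantage.Theorems.StabilizerDial.pad P s) x ↔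 (∑ i, if x i then α k i else 0) ∈ A k) → ¬ (∃ s : Fin n → Literature.Computability.MetaComplexity.Smolensky.CubeFn (ZMod 3) n, (∀ i, s i ∈ Literature.Computability.MetaComplexity.Smolensky.lowDeg (ZMod 3) n ((Nat.log 2 n) ^ (c + 1))) ∧ ∃ (v : Fin n → Fin n → Fin r → ZMod (m + 1)) (G : Fin n → (Fin r → ZMod (m + 1)) → Bool), ∀ x : Fin n → Bool, Summit.QuantumAdvantage.AdviceFreeQNC0.OddZeros x → ∀ k : Fin n, k ∈ Summit.QuantumAdvantage.QuantumAdvantage.Theorems.AnchorDial.dev (Summit.QuantumAdvantage.QuantumAdvantage.Theorems.StabilizerDial.pad P s) x ↔ G k (fun j => ∑ i, if x i then v k i j else 0) = true) → ((Finset.univ.filter fun x : Fin n → Bool => Summit.QuantumAdvantage.AdviceFreeQNC0.OddZeros x ∧ Literature.Computability.QuantumComplexity.RingHLF.Rel x (fun i => decide (P i x = 1))).card : ℝ) ≤ (1 - 1 / (n : ℝ) ^ C) * (2 : ℝ) ^ (n - 1)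

-- parent: DenseGenericLoss3 · glue (gen 3)
/--     item stmt-QuantumAdvantage-27421 · support · rank 304 · closed · proved by Summit.QuantumAdvantage.QuantumAdvantage.Theorems.AbelianDial.counterSplitGlue3b_holds (planner)
    parent: DenseGenericLoss3 · GLUE: children ⟹ parent · by operator
CounterLoss3 → AbelianLoss3 → NonAbelianLoss3 → DenseGenericLoss3: Theorems.AbelianDial.closesD over
the landed counterSplitGlue3 (exact: D ↔ A ∧ S ∧ G, B = 27009 ↔ S ∧ G by
Theorems.AbelianDial.split_iff) -/
@[route_item "route-QuantumAdvantage-SparsityDial"]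
def CounterSplitGlue3b : Prop :=
  CounterLoss3 → AbelianLoss3 → NonAbelianLoss3 → DenseGenericLoss3

-- `CounterSplitGlue3b` holds: proved by `Summit.QuantumAdvantage.QuantumAdvantage.Theorems.AbelianDial.counterSplitGlue3b_holds` (its module imports this route file, so no `_holds` link can be stated here).

/-- item stmt-QuantumAdvantage-27954 · aside · rank 9 · open · by planner
why it might fail: a range-1 phase sum_i [x_i][x_(i+1)] may correlate with the mod-3 prefix-parity automaton unlike affine phases: the 2-state twisted transfer operator could lose the stretch-contraction gap (node §T1/§M2) at some residue, leaving a biased banded-quadratic table class.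
sources: BravyiGossetKonig2018, arXiv:1906.08890, Smolensky1987, BarringtonStraubingTherien1990
[aside] NAMED NEXT RUNG of S (stmt-QuantumAdvantage-27655): RANGE-1 LOCAL HASH TABLES (lens-2 g18
«SparsityDial» REV 5f/5g §J/§K, MovingPointers.lean sha256 8b41ffe8…; text = the node's
`LocalHashTableLossSG3 1` with `IsLocalHash 1` inlined over tree declarations, Iff.rfl — writer g9
kernel check rt-as/MP5g_chk.lean: errors exactly at the 2 must-fail probes, 0 sorry). For every c
there is C such that, eventually in n, every F3 strategy P of output degree (log2 n)^c with no cheap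
one-point normal form (not StabFew 1 0 (c+1) P) which SOME admissible gauge s of degree (log2
n)^(c+1) turns into a TABLE strategy — deviation set on every odd x equal to S(h_1(x),...,h_t(x))
with t <= (log2 n)^c hash trits h_r, each a sum over i of summands reading only the cyclic window
[i, i+1] of the ring (range-1 local; e.g. the banded quadratic sum_i [x_i][x_(i+1)],
`isLocalHash_quadBand`), table values of size <= (log2 n)^c — wins at most (1 - n^(-C))*2^(n-1) odd
inputs of the n-cycle ring game. BELOW S BY NAME for every range w (`localSG_of_sparse` /
`localSG_of_routeS`: the gauge witnesses StabFew((log2 n)^c) 0 (c+1) P, locality not even used) and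
NOT cheaply => S (must-fail). Range 0 (= the gauge- -/
@[route_item "route-QuantumAdvantage-SparsityDial"]
def LocalHashTableLossSG3One : Prop :=
  ∀ c : ℕ, ∃ C : ℕ, ∃ n₀ : ℕ, ∀ n ≥ n₀, ∀ t ≤ (Nat.log 2 n) ^ c, ∀ (h : Fin t → Literature.Computability.MetaComplexity.Smolensky.CubeFn (ZMod 3) n) (S : (Fin t → ZMod 3) → Finset (Fin n)), (∀ r, ∃ f : Fin n → Literature.Computability.MetaComplexity.Smolensky.CubeFn (ZMod 3) n, (∀ i : Fin n, ∀ x y : Fin n → Bool, (∀ j : Fin n, (i.val ≤ j.val ∧ j.val ≤ i.val + 1) ∨ j.val + n ≤ i.val + 1 → x j = y j) → f i x = f i y) ∧ ∀ x, h r x = ∑ i, f i x) → (∀ v, (S v).card ≤ (Nat.log 2 n) ^ c) → ∀ P : Fin n → Literature.Computability.MetaComplexity.Smolensky.CubeFn (ZMod 3) n, (∀ i, P i ∈ Literature.Computability.MetaComplexity.Smolensky.lowDeg (ZMod 3) n ((Nat.log 2 n) ^ c)) → ¬ Summit.QuantumAdvantage.QuantumAdvantage.Theorems.StabilizerDial.StabFew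 1 0 (c + 1) P → (∃ s : Fin n → Literature.Computability.MetaComplexity.Smolensky.CubeFn (ZMod 3) n, (∀ i, s i ∈ Literature.Computability.MetaComplexity.Smolensky.lowDeg (ZMod 3) n ((Nat.log 2 n) ^ (c + 1))) ∧ ∀ x, Summit.QuantumAdvantage.AdviceFreeQNC0.OddZeros x → Summit.QuantumAdvantage.QuantumAdvantage.Theorems.AnchorDial.dev (Summit.QuantumAdvantage.QuantumAdvantage.Theorems.StabilizerDial.pad P s) x = S (fun r => h r x)) → ((Finset.univ.filter fun x : Fin n → Bool => Summit.QuantumAdvantage.AdviceFreeQNC0.OddZeros x ∧ Literature.Computability.QuantumComplexity.RingHLF.Rel x (fun i => decide (P i x = 1))).card : ℝ) ≤ (1 - 1 / (n : ℝ) ^ C) * (2 : ℝ) ^ (n - 1)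

/-- item stmt-QuantumAdvantage-27657 · assembly · rank 1 · open · by planner
sources: BravyiGossetKonig2018
[assembly] SparseGenericLoss3 → DenseGenericLoss3 → the parent item
StabilizerDial.StabGenericLossPos3 (27138) by name. -/
@[route_item "route-QuantumAdvantage-SparsityDial"]
def Assembly : Prop :=
  SparseGenericLoss3 → DenseGenericLoss3 → Summit.QuantumAdvantage.QuantumAdvantage.Theses.StabilizerDial.StabGenericLossPos3

/-! D-0027 §2.1 — DECIDING THEOREM (planner-authored via `route open/edit --closes-file`; by planner-decomp-qadv-writer-1-g8-0 2026-08-31T03:27:08Z):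
its hypotheses are this route's items and its conclusion the registered leaf `Summit.QuantumAdvantage.QuantumAdvantage.Theses.StabilizerDial.StabGenericLossPos3` (rung None, D-0061) (glue_lint), and it elaborates with this file. -/

/-- Deciding theorem of the CHILD route SparsityDial (D-0170 `refines route-QuantumAdvantage-StabilizerDial:StabGenericLossPos3`;
writer g8, 2026-08-31; lens-2 g18 node «SparsityDial» c9ab07ee): the multi-pointer piece S `SparseGenericLoss3` and the XOR piece
D `DenseGenericLoss3` give the parent's declared residual G `StabilizerDial.StabGenericLossPos3` (27138) BY NAME — dichotomy on
`StabFew ((log₂ n)^a) 0 (c+1) P` at the scale `a` named by D, window monotonicity `StabFew 1 0 → StabFew (m+1) r` for the sparse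
branch, loss-shape monotonicity for `C := max`. Self-contained over landed declarations (StabilizerDialGauge, LocusDialPieces);
binders consumed 2/2; 0 sorry. -/
@[closes "route-QuantumAdvantage-SparsityDial"] theorem closes (hS : SparseGenericLoss3) (hD : DenseGenericLoss3) :
    Summit.QuantumAdvantage.QuantumAdvantage.Theses.StabilizerDial.StabGenericLossPos3 := by
  classical
  obtain ⟨a, CD, hDc⟩ := hD
  obtain ⟨CS, hSc⟩ := hS a
  refine ⟨max CS CD, fun m r c => ?_⟩
  obtain ⟨n₁, hn₁⟩ := hSc c
  obtain ⟨n₂, hn₂⟩ := hDc c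
  refine ⟨max (max n₁ n₂) 2, fun n hn P hP hG => ?_⟩
  have hn1 : n₁ ≤ n := le_trans (le_trans (le_max_left _ _) (le_max_left _ _)) hn
  have hn2 : n₂ ≤ n := le_trans (le_trans (le_max_right _ _) (le_max_left _ _)) hn
  have h2 : 2 ≤ n := le_trans (le_max_right _ _) hn
  have h1 : 1 ≤ n := le_trans (by norm_num) h2
  have mono : ∀ {e e' : ℕ}, e ≤ e' → ∀ W : ℝ,
      W ≤ (1 - 1 / (n : ℝ) ^ e) * (2 : ℝ) ^ (n - 1) → W ≤ (1 - 1 / (n : ℝ) ^ e') * (2 : ℝ) ^ (n - 1) := by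
    intro e e' he W h
    have hn1' : (1 : ℝ) ≤ n := by exact_mod_cast h1
    have hpow : (n : ℝ) ^ e ≤ (n : ℝ) ^ e' := pow_le_pow_right₀ hn1' he
    have hpos : (0 : ℝ) < (n : ℝ) ^ e := by positivity
    have hle : 1 / (n : ℝ) ^ e' ≤ 1 / (n : ℝ) ^ e := one_div_le_one_div_of_le hpos hpow
    have hP0 : (0 : ℝ) ≤ (2 : ℝ) ^ (n - 1) := by positivity
    nlinarith
  have hG1 : ¬ Summit.QuantumAdvantage.QuantumAdvantage.Theorems.StabilizerDial.StabFew 1 0 (c + 1) P := by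
    intro h1p
    apply hG
    obtain ⟨s, hs, hF⟩ := h1p
    refine ⟨s, hs, ?_⟩
    unfold Summit.QuantumAdvantage.QuantumAdvantage.Theorems.LocusDial.FewLocus at hF ⊢
    refine le_trans (Nat.mul_le_mul_left _ (Finset.card_le_card fun x hx => ?_)) hF
    rw [Finset.mem_filter] at hx ⊢
    refine ⟨hx.1, hx.2.1, fun hc => hx.2.2 ?_⟩
    obtain ⟨kv, hkv⟩ := hc
    refine ⟨fun _ => kv ⟨0, Nat.one_pos⟩, fun i hi => ?_⟩
    obtain ⟨j, hj1, hj2⟩ := hkv i hi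
    have hj : j = ⟨0, Nat.one_pos⟩ := Subsingleton.elim _ _
    subst hj
    refine ⟨⟨0, Nat.succ_pos _⟩, hj1, ?_⟩
    show i.val ≤ kv ⟨0, Nat.one_pos⟩ + r
    have hj2' : i.val ≤ kv ⟨0, Nat.one_pos⟩ + 0 := hj2
    omega
  by_cases hsp : Summit.QuantumAdvantage.QuantumAdvantage.Theorems.StabilizerDial.StabFew ((Nat.log 2 n) ^ a) 0 (c + 1) P
  · exact mono (le_max_left CS CD) _ (hn₁ n hn1 P hP hsp hG1)
  · exact mono (le_max_right CS CD) _ (hn₂ n hn2 P hP hsp)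

end Summit.QuantumAdvantage.QuantumAdvantage.Theses.SparsityDial
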